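import Summits.QuantumFields.BalabanUV.T4Continuum.Support.SubstrateTransporterSpeciesHolo
import Summits.QuantumFields.BalabanUV.T4Continuum.Support.CovariantVectorCoercive

/-!
# T⁴ programme, SUBSTRATE (shared lattice-gauge analysis library) — THE HOLOMORPHY BALL OF THE TWO-SIDED FLUCTUATION OPERATOR:
# p1's `deltaQT c a Γ R S` ([dict] D-8, `SubstrateTransporterSpecies`) stays INVERTIBLE with `‖greenT‖ ≤ 2/γ` on an operator-norm ball around
# every regular real point, and — along the exponential chart `(expChart R⁰ A, expChartInv R⁰ A)` at a unitary reference field `R⁰` — on a ball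
# `‖A‖ < holoRadius` of chart coordinates (item VECJ-H of MAP v0.5 §O1 D-8 (4)(a)–(c); names N-1: `holoRadius`, `InHoloBall`, `HoloRadiusCompat`)

Substrate cell `b2b-balaban-substrate-*`, seat p3 (typer NEXT v0.5.1 item 2).  NE9's END at the background slot is a CAUCHY estimate in complex chart
coordinates and needs a ball on which the operator datum is holomorphic, i.e. on which `deltaQT` is invertible.  From J-1's LEVEL-FREE coercivity of
the real slice (`CovariantVectorCoercive.coercive_vecOp`; `deltaQT … R (adjOf R) = vecOp …`):
 * (a) **`coercive_add_of_opNorm_le`** ∕ **`coercive_of_opNorm_sub_le`**: `Coercive γ S → ‖T − S‖ ≤ y → Coercive (γ − y) T` ([folklore]);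
 * (b) **`deltaQT_adjOf_eq_vecOp`** (`deltaQT (n) (a′·n^d) Γ R (adjOf R) = vecOp n M a′ Γ R`, `rfl` after `deltaQT_adjOf`),
   **`isUnit_det_deltaQT_of_opNorm_sub_le`** (`Coercive γ (vecOp … R⁰) → 0 < γ → ‖deltaQT … R S − deltaQT … R⁰ (adjOf R⁰)‖ ≤ γ/2 → IsUnit det`),
   **`opNorm_greenT_le_of_opNorm_sub_le`** (`‖greenT … R S‖ ≤ 2/γ`);
 * (c) THE BALL, by CONTINUITY of the polynomial map `A ↦ deltaQT … (expChart R⁰ A) (expChartInv R⁰ A)` at `A = 0` (`continuous_deltaQT_chart`;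
   `expChart_zero`, `adjOf_eq_inv`): **`exists_holoBall`** — for unitary `R⁰` with `Coercive γ (vecOp n M a′ Γ R⁰)`, `0 < γ`:
   `∃ ρ > 0, ∀ A, ‖A‖ < ρ → IsUnit (deltaQT … (expChart R⁰ A) (expChartInv R⁰ A)).det ∧ ‖greenT …‖ ≤ 2/γ`; the NAMES **`holoRadius`** (a choice of
   such `ρ`, `holoRadius_pos`, `isUnit_det_deltaQT_of_inHoloBall`, `opNorm_greenT_le_of_inHoloBall`), **`InHoloBall ρ A := ‖A‖ < ρ`**,
   **`HoloRadiusCompat R ρ := ∀ X, R X ≤ ρ X`** (hypothesis SHAPES read by NE9's `hkp` ∕ NE1′'s `hL3`).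
(d) junction with p1's `SubstrateTransporterSpeciesHolo`: **`ball_subset_regularSetAt`** (the `holoRadius`-ball at level `k`, letters `c = lev k`,
   `a = a′·(lev k)^d`, lies in `regularSetAt`), `opNorm_greenT_le_of_mem_ball`.
The radius is NOT explicit here (continuity); an explicit `ρ(γ, n, d, a′, card o)` is a welcome follower.  Norm scope: `Matrix.Norms.L2Operator` on
colour matrices, Pi-sup on the field `A : Fin d → (Tor (fine n M) × Fin d) → Matrix o o ℂ` (Q-S13).

v1.1 (APPEND-ONLY, §(e)): the N-1 names on p1's TOWER chart space `TowerData P o` in the typer's sketch v0.6 §N1 shapes, with the tower suffix `T`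
(as p1's `expChartT`): **`InHoloBallT R⁰ ρ A := ‖A‖ < ρ`** (`inHoloBallT_iff`, `_zero`, `_apply`, `_of_compat`), `HoloRadiusCompat.trans`,
**`exists_ball_subset_regular`** (`0 ∈ regularSet → ∃ ρ > 0, ∀ A, InHoloBallT P R⁰ ρ A → A ∈ regularSet`, from p1's openness), **`holoRadiusT`** (choice
form; `holoRadiusT_pos`, `inHoloBallT_subset_regular`), and the quantitative level junctions `inHoloBallT_subset_regularSetAt`,
`opNorm_greenT_le_of_inHoloBallT` (the one-level `holoRadius` ball of §(c), which carries `‖greenT‖ ≤ 2/γ`, with the level-`k` letters).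

HONEST FRAMING (T4-DAG p. 1).  Finite-dimensional linear algebra and continuity ([folklore]); no estimate of any NE row; nothing printed is a hypothesis;
the three `def … : Prop`∕data names are hypothesis SHAPES requested by the MAP (N-1), not facts; spine 0/9 unchanged; NOT infinite volume ∕ mass gap ∕ Clay.
HONEST DEPENDENCY: continuum YM on T⁴ ⇐ BetaPertH ∧ nine spine estimates (0/9 proved); BetaPertH ⇐ (D1) ∧ (D4) ∧ CAP+tail; G-an2-4 gates asym, D1 and
NE2/3/4.  ABSOLUTE RULE kept; no `sorry`.
-/

noncomputable section

open scoped BigOperators ComplexConjugate Matrix Matrix.Norms.L2Operator Kronecker ComplexOrder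
open Metric

namespace Summit.QuantumFields.BalabanUV.T4Continuum.CovariantVectorCoerciveHolo

open Literature.MathematicalPhysics.QuantumFieldTheory.Balaban1983to89.B5Prop11Plancherel (Tor fine shiftM)
open Literature.MathematicalPhysics.QuantumFieldTheory.Balaban1983to89.B5Prop11Lower (nsq nsq_nonneg norm_form_le)
open Literature.MathematicalPhysics.QuantumFieldTheory.Balaban1983to89.B5Block118 (bpt tstep)
open Summit.QuantumFields.BalabanUV.T4Continuum
open Summit.QuantumFields.BalabanUV.T4Continuum.BlockMultiplication (siteMul siteMul_apply)
open Summit.QuantumFields.BalabanUV.T4Continuum.ColourCovariantLaplacian (covDc)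
open Summit.QuantumFields.BalabanUV.T4Continuum.CovariantBlockAveraging (transport ContourSystem Qcov)
open Summit.QuantumFields.BalabanUV.T4Continuum.CoerciveInverseTower (Coercive isUnit_of_coercive opNorm_inv_le_of_coercive)
open Summit.QuantumFields.BalabanUV.T4Continuum.SubstrateTransporterSpecies
open Summit.QuantumFields.BalabanUV.T4Continuum.CovariantVectorCoercive (vecOp)

variable {d : ℕ} {o : Type*} [Fintype o] [DecidableEq o]

/-! ## (a) Coercivity is stable under small operator-norm perturbations -/

section Perturb

variable {σ : Type*} [Fintype σ] [DecidableEq σ]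

/-- **`Coercive γ S → ‖E‖ ≤ y → Coercive (γ − y) (S + E)`**: `Re⟨v,(S + E)v⟩ ≥ γ‖v‖² − ‖E‖‖v‖²`. [folklore] -/
theorem coercive_add_of_opNorm_le {S E : Matrix σ σ ℂ} {γ y : ℝ} (hS : Coercive γ S) (hE : ‖E‖ ≤ y) : Coercive (γ - y) (S + E) := by
  intro v
  have h1 := hS v
  have h2 : |(star v ⬝ᵥ (E *ᵥ v)).re| ≤ y * nsq v := by
    have hsq : Real.sqrt (nsq v) * Real.sqrt (nsq v) = nsq v := Real.mul_self_sqrt (nsq_nonneg _)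
    calc |(star v ⬝ᵥ (E *ᵥ v)).re| ≤ ‖star v ⬝ᵥ (E *ᵥ v)‖ := Complex.abs_re_le_norm _
      _ ≤ ‖E‖ * (Real.sqrt (nsq v) * Real.sqrt (nsq v)) := norm_form_le E v v
      _ ≤ y * nsq v := by rw [hsq]; exact mul_le_mul_of_nonneg_right hE (nsq_nonneg _)
  rw [Matrix.add_mulVec, dotProduct_add, Complex.add_re, sub_mul]
  rw [abs_le] at h2
  linarith [h2.1]

/-- **`Coercive γ S → ‖T − S‖ ≤ y → Coercive (γ − y) T`**. [folklore] -/
theorem coercive_of_opNorm_sub_le {S T : Matrix σ σ ℂ} {γ y : ℝ} (hS : Coercive γ S) (hT : ‖T - S‖ ≤ y) : Coercive (γ - y) T := by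
  have h := coercive_add_of_opNorm_le hS hT
  rwa [add_sub_cancel] at h

end Perturb

/-! ## (b) The real slice is `vecOp`; invertibility and the Green's-function bound near it -/

section Slice

variable (n : ℕ) [NeZero n] (M : Fin d → ℕ) [hM : ∀ μ, NeZero (M μ)]

/-- **`deltaQT (n) (a′·n^d) Γ R (adjOf R) = vecOp n M a′ Γ R`** (p1's real-slice identity `deltaQT_adjOf` + the definition of `vecOp`). [folklore] -/
theorem deltaQT_adjOf_eq_vecOp (a' : ℝ) (Γ : ContourSystem d n M) (R : Fin d → (Tor (fine n M) × Fin d → Matrix o o ℂ)) :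
    deltaQT n M ((n : ℕ) : ℂ) (a' * (n : ℝ) ^ d) Γ R (adjOf R) = vecOp n M a' Γ R := by
  rw [deltaQT_adjOf]; rfl

variable {a' γ : ℝ} {Γ : ContourSystem d n M} {R₀ R S : Fin d → (Tor (fine n M) × Fin d → Matrix o o ℂ)}

/-- **coercivity near the real slice**: `‖deltaQT … R S − vecOp … R⁰‖ ≤ γ/2` keeps `γ/2`-coercivity. [folklore] -/
theorem coercive_deltaQT_of_opNorm_sub_le (hco : Coercive γ (vecOp n M a' Γ R₀))
    (hsub : ‖deltaQT n M ((n : ℕ) : ℂ) (a' * (n : ℝ) ^ d) Γ R S - deltaQT n M ((n : ℕ) : ℂ) (a' * (n : ℝ) ^ d) Γ R₀ (adjOf R₀)‖ ≤ γ / 2) :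
    Coercive (γ / 2) (deltaQT n M ((n : ℕ) : ℂ) (a' * (n : ℝ) ^ d) Γ R S) := by
  rw [deltaQT_adjOf_eq_vecOp] at hsub
  have h := coercive_of_opNorm_sub_le hco hsub
  rwa [show γ - γ / 2 = γ / 2 by ring] at h

/-- **`isUnit_det_deltaQT_of_opNorm_sub_le`**: invertibility of the two-sided operator near the regular real point. [folklore] -/
theorem isUnit_det_deltaQT_of_opNorm_sub_le (hco : Coercive γ (vecOp n M a' Γ R₀)) (hγ : 0 < γ)
    (hsub : ‖deltaQT n M ((n : ℕ) : ℂ) (a' * (n : ℝ) ^ d) Γ R S - deltaQT n M ((n : ℕ) : ℂ) (a' * (n : ℝ) ^ d) Γ R₀ (adjOf R₀)‖ ≤ γ / 2) :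
    IsUnit (deltaQT n M ((n : ℕ) : ℂ) (a' * (n : ℝ) ^ d) Γ R S).det :=
  (Matrix.isUnit_iff_isUnit_det _).mp (isUnit_of_coercive (by linarith) (coercive_deltaQT_of_opNorm_sub_le n M hco hsub))

/-- **`‖greenT … R S‖ ≤ 2/γ`** near the regular real point. [folklore] -/
theorem opNorm_greenT_le_of_opNorm_sub_le (hco : Coercive γ (vecOp n M a' Γ R₀)) (hγ : 0 < γ)
    (hsub : ‖deltaQT n M ((n : ℕ) : ℂ) (a' * (n : ℝ) ^ d) Γ R S - deltaQT n M ((n : ℕ) : ℂ) (a' * (n : ℝ) ^ d) Γ R₀ (adjOf R₀)‖ ≤ γ / 2) :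
    ‖greenT n M ((n : ℕ) : ℂ) (a' * (n : ℝ) ^ d) Γ R S‖ ≤ 2 / γ := by
  rw [greenT, show (2 : ℝ) / γ = (γ / 2)⁻¹ by rw [inv_div]]
  exact opNorm_inv_le_of_coercive (by linarith) (coercive_deltaQT_of_opNorm_sub_le n M hco hsub)

end Slice

/-! ## (c) The ball along the exponential chart -/

section Chart

variable (n : ℕ) [NeZero n] (M : Fin d → ℕ) [hM : ∀ μ, NeZero (M μ)]

/-- the matrix exponential is continuous on colour matrices (analytic, `NormedSpace.exp_analytic`). [folklore] -/
theorem continuous_mexp : Continuous (fun X : Matrix o o ℂ => NormedSpace.exp X) :=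
  continuous_iff_continuousAt.2 fun X => (NormedSpace.exp_analytic (𝕂 := ℂ) X).continuousAt

variable {X : Type*} [TopologicalSpace X]

omit [Fintype o] [DecidableEq o] [NeZero n] hM in
/-- `siteMul` of a continuously varying field is continuous. [folklore] -/
theorem continuous_siteMul {κ : Type*} [DecidableEq κ] {w : X → κ → Matrix o o ℂ} (hw : ∀ k, Continuous fun x => w x k) :
    Continuous fun x => siteMul (w x) := by
  refine continuous_matrix fun a b => ?_
  by_cases h : a.1 = b.1
  · simp only [siteMul_apply, if_pos h]; exact (hw a.1).matrix_elem a.2 b.2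
  · simp only [siteMul_apply, if_neg h]; exact continuous_const

omit [NeZero n] hM in
/-- a transport along a fixed bond list varies continuously with the transporter field. [folklore] -/
theorem continuous_transport {Nf : Fin d → ℕ} [∀ μ, NeZero (Nf μ)] {w : X → Fin d → (Tor Nf × Fin d → Matrix o o ℂ)}
    (hw : ∀ ν k, Continuous fun x => w x ν k) (μ : Fin d) (L : List (Tor Nf × Fin d)) : Continuous fun x => transport Nf (w x) μ L := by
  unfold transport
  exact continuous_list_prod L fun b _ => hw b.2 (b.1, μ)

omit [NeZero n] hM in
/-- an adjoint transport along a fixed bond list varies continuously with the transporter field. [folklore] -/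
theorem continuous_transportA {Nf : Fin d → ℕ} [∀ μ, NeZero (Nf μ)] {w : X → Fin d → (Tor Nf × Fin d → Matrix o o ℂ)}
    (hw : ∀ ν k, Continuous fun x => w x ν k) (μ : Fin d) (L : List (Tor Nf × Fin d)) : Continuous fun x => transportA Nf (w x) μ L := by
  unfold transportA
  have h : ∀ x, ((L.map fun b => w x b.2 (b.1, μ)).reverse).prod = ((L.reverse).map fun b => w x b.2 (b.1, μ)).prod := fun x => by rw [List.map_reverse]
  simp_rw [h]
  exact continuous_list_prod L.reverse fun b _ => hw b.2 (b.1, μ)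

/-- `Qcov Γ (w x)` is continuous in `x`. [folklore] -/
theorem continuous_Qcov (Γ : ContourSystem d n M) {w : X → Fin d → (Tor (fine n M) × Fin d → Matrix o o ℂ)} (hw : ∀ ν k, Continuous fun x => w x ν k) :
    Continuous fun x => Qcov n M Γ (w x) := by
  refine continuous_matrix fun b i => ?_
  simp only [Qcov]
  by_cases h : i.1.2 = b.1.2
  · simp only [if_pos h]
    refine continuous_finsetSum _ fun j _ => continuous_finsetSum _ fun t _ => ?_
    by_cases h' : i.1.1 = bpt n M b.1.1 j + tstep (fine n M) b.1.2 t
    · simp only [if_pos h']; exact continuous_const.mul ((continuous_transport hw b.1.2 _).matrix_elem b.2 i.2)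
    · simp only [if_neg h']; exact continuous_const
  · simp only [if_neg h]; exact continuous_const

/-- `QcovA Γ (w x)` is continuous in `x`. [folklore] -/
theorem continuous_QcovA (Γ : ContourSystem d n M) {w : X → Fin d → (Tor (fine n M) × Fin d → Matrix o o ℂ)} (hw : ∀ ν k, Continuous fun x => w x ν k) :
    Continuous fun x => QcovA n M Γ (w x) := by
  refine continuous_matrix fun i b => ?_
  simp only [QcovA]
  by_cases h : i.1.2 = b.1.2
  · simp only [if_pos h]
    refine continuous_finsetSum _ fun j _ => continuous_finsetSum _ fun t _ => ?_
    by_cases h' : i.1.1 = bpt n M b.1.1 j + tstep (fine n M) b.1.2 t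
    · simp only [if_pos h']; exact continuous_const.mul ((continuous_transportA hw b.1.2 _).matrix_elem i.2 b.2)
    · simp only [if_neg h']; exact continuous_const
  · simp only [if_neg h]; exact continuous_const

/-- `deltaQT c a Γ (R x) (S x)` is continuous in `x` (a polynomial in the transporter entries). [folklore] -/
theorem continuous_deltaQT (c : ℂ) (a : ℝ) (Γ : ContourSystem d n M) {R S : X → Fin d → (Tor (fine n M) × Fin d → Matrix o o ℂ)}
    (hR : ∀ ν k, Continuous fun x => R x ν k) (hS : ∀ ν k, Continuous fun x => S x ν k) :
    Continuous fun x => deltaQT n M c a Γ (R x) (S x) := by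
  unfold deltaQT covLapT covDcA covDc
  refine Continuous.add ?_ ?_
  · refine continuous_finsetSum _ fun ν _ => ?_
    have h1 : Continuous fun x => siteMul (S x ν) := continuous_siteMul (hS ν)
    have h2 : Continuous fun x => siteMul (R x ν) := continuous_siteMul (hR ν)
    fun_prop
  · have h3 : Continuous fun x => QcovA n M Γ (S x) := continuous_QcovA n M Γ hS
    have h4 : Continuous fun x => Qcov n M Γ (R x) := continuous_Qcov n M Γ hR
    fun_prop

/-- the chart map `A ↦ deltaQT … (expChart R⁰ A) (expChartInv R⁰ A)` is continuous. [folklore] -/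
theorem continuous_deltaQT_chart (c : ℂ) (a : ℝ) (Γ : ContourSystem d n M) (R₀ : Fin d → (Tor (fine n M) × Fin d → Matrix o o ℂ)) :
    Continuous fun A : Fin d → (Tor (fine n M) × Fin d → Matrix o o ℂ) => deltaQT n M c a Γ (expChart R₀ A) (expChartInv R₀ A) := by
  have hA : ∀ ν k, Continuous fun A : Fin d → (Tor (fine n M) × Fin d → Matrix o o ℂ) => A ν k :=
    fun ν k => (continuous_apply k).comp (continuous_apply ν)
  refine continuous_deltaQT n M c a Γ (fun ν k => ?_) (fun ν k => ?_)
  · simp only [expChart_apply]; exact (continuous_mexp.comp (hA ν k)).mul continuous_const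
  · simp only [expChartInv_apply]; exact continuous_const.mul (continuous_mexp.comp (hA ν k).neg)

variable {a' γ : ℝ} {Γ : ContourSystem d n M} {R₀ : Fin d → (Tor (fine n M) × Fin d → Matrix o o ℂ)}

/-- at `A = 0` the chart map is the real slice `vecOp … R⁰` (unitary `R⁰`: `(R⁰)⁻¹ = adjOf R⁰`). [folklore] -/
theorem deltaQT_chart_zero (hR₀ : ∀ ν k, R₀ ν k ∈ Matrix.unitaryGroup o ℂ) (a' : ℝ) (Γ : ContourSystem d n M) :
    deltaQT n M ((n : ℕ) : ℂ) (a' * (n : ℝ) ^ d) Γ (expChart R₀ 0) (expChartInv R₀ 0) = vecOp n M a' Γ R₀ := by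
  rw [expChart_zero, expChartInv_zero, ← adjOf_eq_inv hR₀, deltaQT_adjOf_eq_vecOp]

/-- **THE HOLOMORPHY BALL**: for a unitary reference field `R⁰` at which the real slice is `γ`-coercive (`γ > 0`) there is `ρ > 0` such that for every
chart coordinate `A` with `‖A‖ < ρ` the two-sided operator `deltaQT … (expChart R⁰ A) (expChartInv R⁰ A)` is invertible and `‖greenT‖ ≤ 2/γ`. [folklore] -/
theorem exists_holoBall (hR₀ : ∀ ν k, R₀ ν k ∈ Matrix.unitaryGroup o ℂ) (hco : Coercive γ (vecOp n M a' Γ R₀)) (hγ : 0 < γ) :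
    ∃ ρ : ℝ, 0 < ρ ∧ ∀ A : Fin d → (Tor (fine n M) × Fin d → Matrix o o ℂ), ‖A‖ < ρ →
      IsUnit (deltaQT n M ((n : ℕ) : ℂ) (a' * (n : ℝ) ^ d) Γ (expChart R₀ A) (expChartInv R₀ A)).det ∧
        ‖greenT n M ((n : ℕ) : ℂ) (a' * (n : ℝ) ^ d) Γ (expChart R₀ A) (expChartInv R₀ A)‖ ≤ 2 / γ := by
  have hc := (continuous_deltaQT_chart n M ((n : ℕ) : ℂ) (a' * (n : ℝ) ^ d) Γ R₀).continuousAt (x := 0)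
  rw [ContinuousAt, Metric.tendsto_nhds_nhds] at hc
  obtain ⟨ρ, hρ, hball⟩ := hc (γ / 2) (by linarith)
  refine ⟨ρ, hρ, fun A hA => ?_⟩
  have hdist : dist A 0 < ρ := by rwa [dist_zero_right]
  have hsub : ‖deltaQT n M ((n : ℕ) : ℂ) (a' * (n : ℝ) ^ d) Γ (expChart R₀ A) (expChartInv R₀ A)
      - deltaQT n M ((n : ℕ) : ℂ) (a' * (n : ℝ) ^ d) Γ R₀ (adjOf R₀)‖ ≤ γ / 2 := by
    have h := hball hdist
    rw [dist_eq_norm, deltaQT_chart_zero n M hR₀, ← deltaQT_adjOf_eq_vecOp] at h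
    exact h.le
  exact ⟨isUnit_det_deltaQT_of_opNorm_sub_le n M hco hγ hsub, opNorm_greenT_le_of_opNorm_sub_le n M hco hγ hsub⟩

/-! ### The names of record (MAP v0.5 §O1 N-1) -/

/-- **`holoRadius`**: a radius of chart coordinates around the unitary, `γ`-coercive reference field `R⁰` on which `deltaQT` is invertible with
`‖greenT‖ ≤ 2/γ` (a choice from `exists_holoBall`). [folklore] -/
def holoRadius (hR₀ : ∀ ν k, R₀ ν k ∈ Matrix.unitaryGroup o ℂ) (hco : Coercive γ (vecOp n M a' Γ R₀)) (hγ : 0 < γ) : ℝ :=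
  Classical.choose (exists_holoBall n M hR₀ hco hγ)

/-- `holoRadius > 0`. [folklore] -/
theorem holoRadius_pos (hR₀ : ∀ ν k, R₀ ν k ∈ Matrix.unitaryGroup o ℂ) (hco : Coercive γ (vecOp n M a' Γ R₀)) (hγ : 0 < γ) :
    0 < holoRadius n M hR₀ hco hγ :=
  (Classical.choose_spec (exists_holoBall n M hR₀ hco hγ)).1

/-- HYPOTHESIS SHAPE **`InHoloBall ρ A`**: the chart coordinate lies in the ball of radius `ρ`. [folklore] -/
def InHoloBall (ρ : ℝ) (A : Fin d → (Tor (fine n M) × Fin d → Matrix o o ℂ)) : Prop := ‖A‖ < ρ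

/-- HYPOTHESIS SHAPE **`HoloRadiusCompat R ρ`**: a family of radii `R X` (e.g. NE9's `D.R`) is dominated by the holomorphy radii `ρ X`. [folklore] -/
def HoloRadiusCompat {Dom : Type*} (R ρ : Dom → ℝ) : Prop := ∀ X, R X ≤ ρ X

omit [Fintype o] [DecidableEq o] in
/-- a family of radii is compatible with itself. [folklore] -/
theorem holoRadiusCompat_refl {Dom : Type*} (ρ : Dom → ℝ) : HoloRadiusCompat ρ ρ := fun _ => le_rfl

/-- inside the holomorphy ball the two-sided operator is invertible. [folklore] -/
theorem isUnit_det_deltaQT_of_inHoloBall (hR₀ : ∀ ν k, R₀ ν k ∈ Matrix.unitaryGroup o ℂ) (hco : Coercive γ (vecOp n M a' Γ R₀)) (hγ : 0 < γ)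
    {A : Fin d → (Tor (fine n M) × Fin d → Matrix o o ℂ)} (hA : InHoloBall n M (holoRadius n M hR₀ hco hγ) A) :
    IsUnit (deltaQT n M ((n : ℕ) : ℂ) (a' * (n : ℝ) ^ d) Γ (expChart R₀ A) (expChartInv R₀ A)).det :=
  ((Classical.choose_spec (exists_holoBall n M hR₀ hco hγ)).2 A hA).1

/-- inside the holomorphy ball `‖greenT‖ ≤ 2/γ`. [folklore] -/
theorem opNorm_greenT_le_of_inHoloBall (hR₀ : ∀ ν k, R₀ ν k ∈ Matrix.unitaryGroup o ℂ) (hco : Coercive γ (vecOp n M a' Γ R₀)) (hγ : 0 < γ)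
    {A : Fin d → (Tor (fine n M) × Fin d → Matrix o o ℂ)} (hA : InHoloBall n M (holoRadius n M hR₀ hco hγ) A) :
    ‖greenT n M ((n : ℕ) : ℂ) (a' * (n : ℝ) ^ d) Γ (expChart R₀ A) (expChartInv R₀ A)‖ ≤ 2 / γ :=
  ((Classical.choose_spec (exists_holoBall n M hR₀ hco hγ)).2 A hA).2

/-- a compatible family of radii places every admissible coordinate inside the holomorphy ball. [folklore] -/
theorem inHoloBall_of_compat {Dom : Type*} {R ρ : Dom → ℝ} (h : HoloRadiusCompat R ρ) (X : Dom)
    {A : Fin d → (Tor (fine n M) × Fin d → Matrix o o ℂ)} (hA : ‖A‖ < R X) : InHoloBall n M (ρ X) A :=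
  lt_of_lt_of_le hA (h X)

end Chart

/-! ## (d) Junction with p1's regular set of the tower chart (`SubstrateTransporterSpeciesHolo.regularSetAt`) -/

section Tower

open Literature.MathematicalPhysics.QuantumFieldTheory.Balaban1983to89 (Params)
open Summit.QuantumFields.BalabanUV.T4Continuum.SubstrateBackgroundTransporters (unitMod)
open Literature.MathematicalPhysics.QuantumFieldTheory.Balaban1983to89.B5G183RateUnitTower (lev lev_neZero)
open Summit.QuantumFields.BalabanUV.T4Continuum.SubstrateTransporterSpeciesHolo (expChartT expChartInvT regularSetAt)

/-- **THE QUANTITATIVE BALL SITS IN p1's REGULAR SET**: at NE2 level `k`, with the level-`k` letters `c = lev k`, `a = a′·(lev k)^d`, the chart ball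
of radius `holoRadius` around a unitary, `γ`-coercive level-`k` reference field lies in `regularSetAt` (Pi-sup norm: `‖A k‖ ≤ ‖A‖`). [folklore] -/
theorem ball_subset_regularSetAt (P : Params) (Γ : (k : ℕ) → ContourSystem P.d (lev P.L k) (unitMod P)) {R₀ : TowerData P o} (k : Fin (P.K + 1))
    (hR₀ : ∀ ν i, R₀ k ν i ∈ Matrix.unitaryGroup o ℂ) {a' γ : ℝ} (hco : Coercive γ (vecOp (lev P.L k) (unitMod P) a' (Γ k) (R₀ k))) (hγ : 0 < γ) :
    Metric.ball (0 : TowerData P o) (holoRadius (lev P.L k) (unitMod P) hR₀ hco hγ)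
      ⊆ regularSetAt P (((lev P.L k : ℕ) : ℂ)) (a' * ((lev P.L k : ℕ) : ℝ) ^ P.d) Γ R₀ k := by
  intro A hA
  rw [Metric.mem_ball, dist_zero_right] at hA
  exact isUnit_det_deltaQT_of_inHoloBall (lev P.L k) (unitMod P) hR₀ hco hγ (lt_of_le_of_lt (norm_le_pi_norm A k) hA)

/-- … and there `‖greenT‖ ≤ 2/γ` at level `k`. [folklore] -/
theorem opNorm_greenT_le_of_mem_ball (P : Params) (Γ : (k : ℕ) → ContourSystem P.d (lev P.L k) (unitMod P)) {R₀ : TowerData P o} (k : Fin (P.K + 1))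
    (hR₀ : ∀ ν i, R₀ k ν i ∈ Matrix.unitaryGroup o ℂ) {a' γ : ℝ} (hco : Coercive γ (vecOp (lev P.L k) (unitMod P) a' (Γ k) (R₀ k))) (hγ : 0 < γ)
    {A : TowerData P o} (hA : ‖A‖ < holoRadius (lev P.L k) (unitMod P) hR₀ hco hγ) :
    ‖greenT (lev P.L k) (unitMod P) (((lev P.L k : ℕ) : ℂ)) (a' * ((lev P.L k : ℕ) : ℝ) ^ P.d) (Γ k) (expChartT P R₀ A k) (expChartInvT P R₀ A k)‖ ≤ 2 / γ :=
  opNorm_greenT_le_of_inHoloBall (lev P.L k) (unitMod P) hR₀ hco hγ (lt_of_le_of_lt (norm_le_pi_norm A k) hA)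

end Tower

/-! ## (e) v1.1 (APPEND-ONLY) — THE N-1 NAMES ON p1's TOWER CHART SPACE `TowerData P o` (typer sketch v0.6 §N1 shapes, tower suffix `T` as in
p1's `expChartT` ∕ `expChartInvT`): `InHoloBallT`, `HoloRadiusCompat.trans`, `exists_ball_subset_regular`, `holoRadiusT`, and the per-level junctions -/

section TowerNames

open Literature.MathematicalPhysics.QuantumFieldTheory.Balaban1983to89 (Params)
open Summit.QuantumFields.BalabanUV.T4Continuum.SubstrateBackgroundTransporters (unitMod)
open Literature.MathematicalPhysics.QuantumFieldTheory.Balaban1983to89.B5G183RateUnitTower (lev lev_neZero)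
open Summit.QuantumFields.BalabanUV.T4Continuum.SubstrateTransporterSpeciesHolo (expChartT expChartInvT regularSetAt regularSet exists_ball_subset_regularSet)

variable (P : Params)

/-- HYPOTHESIS SHAPE **`InHoloBallT R⁰ ρ A`** (N-1 on TOWER data; sketch §N1 `InHoloBall`): the tower chart coordinate `A` (chart centred at `R⁰`, a
bookkeeping tag) lies in the ball of radius `ρ` — Pi-sup of `L²`-operator norms (Q-S13).  Level by level it gives the one-level `InHoloBall`
(`inHoloBallT_apply`). [folklore] -/
def InHoloBallT (_R₀ : TowerData P o) (ρ : ℝ) (A : TowerData P o) : Prop := ‖A‖ < ρ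

/-- `InHoloBallT R⁰ ρ A ↔ A ∈ ball 0 ρ`. [folklore] -/
theorem inHoloBallT_iff (R₀ : TowerData P o) (ρ : ℝ) (A : TowerData P o) : InHoloBallT P R₀ ρ A ↔ A ∈ Metric.ball (0 : TowerData P o) ρ := by
  rw [InHoloBallT, Metric.mem_ball, dist_zero_right]

/-- the centre is in every ball of positive radius. [folklore] -/
theorem inHoloBallT_zero (R₀ : TowerData P o) {ρ : ℝ} (hρ : 0 < ρ) : InHoloBallT P R₀ ρ 0 := by
  rw [InHoloBallT, norm_zero]; exact hρ

/-- level by level: `InHoloBallT R⁰ ρ A → InHoloBall (lev k) (unitMod P) ρ (A k)` (`‖A k‖ ≤ ‖A‖`). [folklore] -/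
theorem inHoloBallT_apply {R₀ : TowerData P o} {ρ : ℝ} {A : TowerData P o} (hA : InHoloBallT P R₀ ρ A) (k : Fin (P.K + 1)) :
    InHoloBall (lev P.L k) (unitMod P) ρ (A k) :=
  lt_of_le_of_lt (norm_le_pi_norm A k) hA

omit [Fintype o] [DecidableEq o] in
/-- `HoloRadiusCompat` is transitive. [folklore] -/
theorem HoloRadiusCompat.trans {Dom : Type*} {R ρ σ : Dom → ℝ} (h₁ : HoloRadiusCompat R ρ) (h₂ : HoloRadiusCompat ρ σ) : HoloRadiusCompat R σ :=
  fun X => (h₁ X).trans (h₂ X)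

/-- compatible radii put every admissible tower coordinate in the holo ball. [folklore] -/
theorem inHoloBallT_of_compat {Dom : Type*} {R ρ : Dom → ℝ} (h : HoloRadiusCompat R ρ) (X : Dom) (R₀ : TowerData P o) {A : TowerData P o}
    (hA : ‖A‖ < R X) : InHoloBallT P R₀ (ρ X) A :=
  lt_of_lt_of_le hA (h X)

variable (c : ℂ) (a : ℝ) (Γ : (k : ℕ) → ContourSystem P.d (lev P.L k) (unitMod P))

/-- **VECJ-H (c), qualitative tower form** (sketch `ExistsBallSubsetRegular_stmt`): a regular centre carries a whole `InHoloBallT` of regular tower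
coordinates (p1's `isOpen_regularSet` ∕ `exists_ball_subset_regularSet`). [folklore] -/
theorem exists_ball_subset_regular {R₀ : TowerData P o} (h0 : (0 : TowerData P o) ∈ regularSet P c a Γ R₀) :
    ∃ ρ : ℝ, 0 < ρ ∧ ∀ A, InHoloBallT P R₀ ρ A → A ∈ regularSet P c a Γ R₀ := by
  obtain ⟨ρ, hρ, hsub⟩ := exists_ball_subset_regularSet P c a Γ h0
  exact ⟨ρ, hρ, fun A hA => hsub ((inHoloBallT_iff P R₀ ρ A).1 hA)⟩

/-- **`holoRadiusT`** — THE tower radius of record (sketch §N1 `holoRadius`), by choice from an existence statement of the shape of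
`exists_ball_subset_regular`. [folklore] -/
def holoRadiusT {R₀ : TowerData P o} (h : ∃ ρ : ℝ, 0 < ρ ∧ ∀ A, InHoloBallT P R₀ ρ A → A ∈ regularSet P c a Γ R₀) : ℝ := h.choose

/-- `holoRadiusT > 0`. [folklore] -/
theorem holoRadiusT_pos {R₀ : TowerData P o} (h : ∃ ρ : ℝ, 0 < ρ ∧ ∀ A, InHoloBallT P R₀ ρ A → A ∈ regularSet P c a Γ R₀) :
    0 < holoRadiusT P c a Γ h := h.choose_spec.1

/-- inside `holoRadiusT` every tower coordinate is regular. [folklore] -/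
theorem inHoloBallT_subset_regular {R₀ : TowerData P o} (h : ∃ ρ : ℝ, 0 < ρ ∧ ∀ A, InHoloBallT P R₀ ρ A → A ∈ regularSet P c a Γ R₀)
    {A : TowerData P o} (hA : InHoloBallT P R₀ (holoRadiusT P c a Γ h) A) : A ∈ regularSet P c a Γ R₀ := h.choose_spec.2 A hA

/-- **QUANTITATIVE LEVEL JUNCTION**: the tower ball of radius `holoRadius (lev k) (unitMod P) …` (§(c), carries `‖greenT‖ ≤ 2/γ`) lies in p1's
level-`k` regular set with the level-`k` letters `c = lev k`, `a = a′·(lev k)^d`. [folklore] -/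
theorem inHoloBallT_subset_regularSetAt {R₀ : TowerData P o} (k : Fin (P.K + 1)) (hR₀ : ∀ ν i, R₀ k ν i ∈ Matrix.unitaryGroup o ℂ) {a' γ : ℝ}
    (hco : Coercive γ (vecOp (lev P.L k) (unitMod P) a' (Γ k) (R₀ k))) (hγ : 0 < γ) {A : TowerData P o}
    (hA : InHoloBallT P R₀ (holoRadius (lev P.L k) (unitMod P) hR₀ hco hγ) A) :
    A ∈ regularSetAt P (((lev P.L k : ℕ) : ℂ)) (a' * ((lev P.L k : ℕ) : ℝ) ^ P.d) Γ R₀ k :=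
  isUnit_det_deltaQT_of_inHoloBall (lev P.L k) (unitMod P) hR₀ hco hγ (inHoloBallT_apply P hA k)

/-- … with `‖greenT‖ ≤ 2/γ` at level `k`. [folklore] -/
theorem opNorm_greenT_le_of_inHoloBallT {R₀ : TowerData P o} (k : Fin (P.K + 1)) (hR₀ : ∀ ν i, R₀ k ν i ∈ Matrix.unitaryGroup o ℂ) {a' γ : ℝ}
    (hco : Coercive γ (vecOp (lev P.L k) (unitMod P) a' (Γ k) (R₀ k))) (hγ : 0 < γ) {A : TowerData P o}
    (hA : InHoloBallT P R₀ (holoRadius (lev P.L k) (unitMod P) hR₀ hco hγ) A) :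
    ‖greenT (lev P.L k) (unitMod P) (((lev P.L k : ℕ) : ℂ)) (a' * ((lev P.L k : ℕ) : ℝ) ^ P.d) (Γ k) (expChartT P R₀ A k) (expChartInvT P R₀ A k)‖ ≤ 2 / γ :=
  opNorm_greenT_le_of_inHoloBall (lev P.L k) (unitMod P) hR₀ hco hγ (inHoloBallT_apply P hA k)

end TowerNames

end Summit.QuantumFields.BalabanUV.T4Continuum.CovariantVectorCoerciveHolo

end
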